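import Summits.AtomisticToContinuum.HydrodynamicLimit.Theorems.InformationPercolationEngineChaosClosesEulerLocalEquilibriumFromDissipationF
import HarnessLib

/-!
# Pointwise local equilibrium from the empirical H-theorem (crux `ChaosClosesEuler`, stmt-AtomisticToContinuum-15141,
# line `empirical-h-theorem`, stub `stub_localEquilibriumFromDissipation`) — helper G: the deterministic core

WHAT. The pathwise heart of the assembly.  `pointwise_core`: at ONE window `(w, x)`, given dissipation rigidity
(already applied to the cone law, helper C) at tolerance `ε′` on the class `ρ₁ ≤ ρ_r ≤ η_P/σ³`, tails `≤ 1/(j+1)`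
(`j ≤ n`), `θ_r ≥ θ₁`, `D ≤ η_r`, a state weight `h` supported in the bulk `{ρ₁ < ρ, σ³ρ < η_P, θ > θ₁}` with
`|h| ≤ C_h`, a bounded test `|ψ| ≤ C_ψ` and a density weight with `h_ρ(a) Y(σ³a) ≥ c_Y > 0` on the band:
`|h(state)| · |M_ψ − ρ_r ∫ψ M_{1,θ_r,u_r}| ≤ C_h ε′ + B₀ · ( (2/(η_r c_Y)) · h_ρ(ρ_r) Y(σ³ρ_r) 𝒫 + Σ_{j ≤ n} (j+1) M(cubeTail (Lt j)) )`,
`B₀ = C_h · 2C_ψ η_P/σ³` — a trichotomy: either rigidity applies (`D = 2𝒫 ≤ η_r`, tails fine), or some tail fails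
(then `(j+1)·M(cubeTail_j) > 1`), or `𝒫 > η_r/2` (then the weighted prediction exceeds `c_Y η_r/2`); in the last two
cases the crude bound `B₀` is absorbed by the corresponding nonnegative functional.  `core_integral_le`: the same
integrated over `[0, t] × 𝕋³` along a good orbit (the dominating field is bounded and jointly measurable, helper E;
`∫ₓ M(cubeTail) = mean cubic tail`, `integral_MpsiC`).

References: elementary. No named fact is invoked.
-/

noncomputable section

namespace Summit.AtomisticToContinuum.HydrodynamicLimit.Theorems.ChaosClosesEulerLocalEquilibriumFromDissipation

open scoped BigOperators Topology Classical MeasureTheory ENNReal InnerProductSpace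
open Filter Set MeasureTheory Function
open Literature.MathematicalPhysics.KineticTheory
open Literature.Analysis.FluidPDE
open Summit.AtomisticToContinuum.HydrodynamicLimit.Theorems.LocalSecondLawNegative
open Summit.AtomisticToContinuum.HydrodynamicLimit.Theorems.LocalSecondLawLedger
open Summit.AtomisticToContinuum.HydrodynamicLimit.Theorems.ChaosClosesEulerPressureValue
  (abs_setIntegral_integral_le setIntegral_integral_add setIntegral_integral_const_mul abs_setIntegral_integral_le_of_le
    integrable_slice integrableOn_integral_slice)
open Summit.AtomisticToContinuum.HydrodynamicLimit.Theorems.ChaosClosesEulerStressIsotropy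
  (MpsiC MpsiC_eq_sum MpsiC_mono MpsiC_nonneg abs_MpsiC_le_mul_rhoC continuous_MpsiC integral_MpsiC sqTail cubeTail
    cubeTail_nonneg sqTail_le_cubeTail measurable_cubeTail measurable_MpsiC_orbit mean_cubeTail_le ke_flow_eq'
    integrableOn_mean_cubeTail)

variable {σ : ℝ} {N : ℕ}

/-! ## §1 The pointwise trichotomy -/

/-- **THE POINTWISE CORE (trichotomy at one window).** See the module docstring. [folklore] -/
theorem pointwise_core {r : ℝ} (hr : 0 < r) {δ : ℝ} (hδ : 0 < δ) (hσ : 0 < σ) (K L : ℝ) {ψ : V3 → ℝ}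
    {Cψ : ℝ} (hψb : ∀ v, |ψ v| ≤ Cψ) (hMψ : ∀ θ : ℝ, 0 < θ → ∀ u : V3, |∫ v, ψ v * localMaxwellian 1 θ u v| ≤ Cψ)
    {h : ℝ × V3 × ℝ → ℝ} {Ch : ℝ} (hhb : ∀ p, |h p| ≤ Ch) {ρ₁ θ₁ Θ U ηP : ℝ} (hθ₁ : 0 < θ₁) (hηP : 0 ≤ ηP)
    (hsupp : ∀ p : ℝ × V3 × ℝ, (p.1 ≤ ρ₁ ∨ ηP ≤ σ ^ 3 * p.1 ∨ p.2.2 ≤ θ₁ ∨ Θ ≤ p.2.2 ∨ U ≤ ‖p.2.1‖) → h p = 0)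
    {hρ Y : ℝ → ℝ} (hF0 : ∀ a, 0 ≤ hρ a * Y (σ ^ 3 * a)) {cY : ℝ} (hcY : 0 < cY)
    (hYc : ∀ a, ρ₁ ≤ a → σ ^ 3 * a ≤ ηP → cY ≤ hρ a * Y (σ ^ 3 * a))
    {Lt : ℕ → ℝ} (hLt : ∀ j, 1 ≤ Lt j) {n : ℕ} {ηr ε' : ℝ} (hηr : 0 < ηr) (hε' : 0 ≤ ε')
    (hDRa : ∀ (w : Phase N) (x : T3), ρ₁ ≤ rhoC r w x → rhoC r w x ≤ ηP / σ ^ 3 →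
      (∀ j : ℕ, j ≤ n → MpsiC r w x (sqTail (Lt j)) ≤ 1 / ((j : ℝ) + 1)) → θ₁ ≤ thetaC r w x →
      DissC r δ K L w x ≤ ηr →
      |MpsiC r w x ψ - rhoC r w x * ∫ v, ψ v * localMaxwellian 1 (thetaC r w x) (uC r w x) v| ≤ ε')
    (w : Phase N) (x : T3) :
    |h (rhoC r w x, uC r w x, thetaC r w x)| *
        |MpsiC r w x ψ - rhoC r w x * ∫ v, ψ v * localMaxwellian 1 (thetaC r w x) (uC r w x) v| ≤
      Ch * ε' + Ch * (2 * Cψ * (ηP / σ ^ 3)) *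
        (2 / (ηr * cY) * (hρ (rhoC r w x) * Y (σ ^ 3 * rhoC r w x) * PredC r δ K L w x) +
          ∑ j ∈ Finset.range (n + 1), ((j : ℝ) + 1) * MpsiC r w x (cubeTail (Lt j))) := by
  have hCh0 : 0 ≤ Ch := (abs_nonneg _).trans (hhb (0, 0, 0))
  have hCψ0 : 0 ≤ Cψ := (abs_nonneg _).trans (hψb 0)
  have hσ3 : 0 < σ ^ 3 := pow_pos hσ 3
  have hP0 := PredC_nonneg hr hδ K L w x
  have hT0 : ∀ j, 0 ≤ MpsiC r w x (cubeTail (Lt j)) := fun j => MpsiC_nonneg hr w x fun v => cubeTail_nonneg _ v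
  have hS0 : 0 ≤ ∑ j ∈ Finset.range (n + 1), ((j : ℝ) + 1) * MpsiC r w x (cubeTail (Lt j)) :=
    Finset.sum_nonneg fun j _ => mul_nonneg (by positivity) (hT0 j)
  have hW0 : 0 ≤ hρ (rhoC r w x) * Y (σ ^ 3 * rhoC r w x) * PredC r δ K L w x := mul_nonneg (hF0 _) hP0
  have hB₀ : 0 ≤ Ch * (2 * Cψ * (ηP / σ ^ 3)) := by positivity
  have hbr0 : 0 ≤ 2 / (ηr * cY) * (hρ (rhoC r w x) * Y (σ ^ 3 * rhoC r w x) * PredC r δ K L w x) +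
      ∑ j ∈ Finset.range (n + 1), ((j : ℝ) + 1) * MpsiC r w x (cubeTail (Lt j)) :=
    add_nonneg (mul_nonneg (by positivity) hW0) hS0
  by_cases h0 : h (rhoC r w x, uC r w x, thetaC r w x) = 0
  · rw [h0, abs_zero, zero_mul]
    exact add_nonneg (mul_nonneg hCh0 hε') (mul_nonneg hB₀ hbr0)
  · -- bulk facts from the support of `h`
    have hρ1 : ρ₁ < rhoC r w x := lt_of_not_ge fun hle => h0 (hsupp _ (Or.inl hle))
    have hρ2 : σ ^ 3 * rhoC r w x < ηP := lt_of_not_ge fun hle => h0 (hsupp _ (Or.inr (Or.inl hle)))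
    have hθ : θ₁ < thetaC r w x := lt_of_not_ge fun hle => h0 (hsupp _ (Or.inr (Or.inr (Or.inl hle))))
    have hρ2' : rhoC r w x ≤ ηP / σ ^ 3 := by
      rw [le_div_iff₀ hσ3]; nlinarith
    -- the crude bound
    have hcrude : |h (rhoC r w x, uC r w x, thetaC r w x)| *
        |MpsiC r w x ψ - rhoC r w x * ∫ v, ψ v * localMaxwellian 1 (thetaC r w x) (uC r w x) v| ≤
        Ch * (2 * Cψ * (ηP / σ ^ 3)) := by
      have hρ0 := rhoC_nonneg hr w x
      have h1 : |MpsiC r w x ψ| ≤ Cψ * rhoC r w x := abs_MpsiC_le_mul_rhoC hr w x hψb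
      have h2 : |rhoC r w x * ∫ v, ψ v * localMaxwellian 1 (thetaC r w x) (uC r w x) v| ≤ rhoC r w x * Cψ := by
        rw [abs_mul, abs_of_nonneg hρ0]
        exact mul_le_mul_of_nonneg_left (hMψ _ (hθ₁.trans hθ) _) hρ0
      have h3 : |MpsiC r w x ψ - rhoC r w x * ∫ v, ψ v * localMaxwellian 1 (thetaC r w x) (uC r w x) v| ≤
          2 * Cψ * (ηP / σ ^ 3) := by
        refine (abs_sub _ _).trans ?_
        calc |MpsiC r w x ψ| + |rhoC r w x * ∫ v, ψ v * localMaxwellian 1 (thetaC r w x) (uC r w x) v|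
            ≤ Cψ * rhoC r w x + rhoC r w x * Cψ := add_le_add h1 h2
          _ = 2 * Cψ * rhoC r w x := by ring
          _ ≤ 2 * Cψ * (ηP / σ ^ 3) := mul_le_mul_of_nonneg_left hρ2' (by positivity)
      exact mul_le_mul (hhb _) h3 (abs_nonneg _) hCh0
    by_cases hA : (∀ j : ℕ, j ≤ n → MpsiC r w x (sqTail (Lt j)) ≤ 1 / ((j : ℝ) + 1)) ∧ PredC r δ K L w x ≤ ηr / 2
    · -- Case A: rigidity applies
      have hD : DissC r δ K L w x ≤ ηr := by rw [DissC_eq_two_mul_PredC hr hδ]; linarith [hA.2]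
      have hR := hDRa w x hρ1.le hρ2' hA.1 hθ.le hD
      calc _ ≤ Ch * ε' := mul_le_mul (hhb _) hR (abs_nonneg _) hCh0
        _ ≤ _ := le_add_of_nonneg_right (mul_nonneg hB₀ hbr0)
    · rw [not_and_or] at hA
      rcases hA with hB | hC
      · -- Case B: a tail fails
        push Not at hB
        obtain ⟨j, hjn, hj⟩ := hB
        have hj1 : (0 : ℝ) < (j : ℝ) + 1 := by positivity
        have hmono : MpsiC r w x (sqTail (Lt j)) ≤ MpsiC r w x (cubeTail (Lt j)) :=
          MpsiC_mono hr w x fun v => sqTail_le_cubeTail (hLt j) v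
        have hTj : 1 < ((j : ℝ) + 1) * MpsiC r w x (cubeTail (Lt j)) := by
          have h1 : 1 < ((j : ℝ) + 1) * MpsiC r w x (sqTail (Lt j)) := by
            rw [div_lt_iff₀' hj1] at hj; exact hj
          exact h1.trans_le (mul_le_mul_of_nonneg_left hmono hj1.le)
        have hsingle : ((j : ℝ) + 1) * MpsiC r w x (cubeTail (Lt j)) ≤
            ∑ j ∈ Finset.range (n + 1), ((j : ℝ) + 1) * MpsiC r w x (cubeTail (Lt j)) :=
          Finset.single_le_sum (f := fun j : ℕ => ((j : ℝ) + 1) * MpsiC r w x (cubeTail (Lt j)))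
            (fun j _ => mul_nonneg (by positivity) (hT0 j)) (Finset.mem_range.2 (Nat.lt_succ_of_le hjn))
        calc _ ≤ Ch * (2 * Cψ * (ηP / σ ^ 3)) := hcrude
          _ ≤ Ch * (2 * Cψ * (ηP / σ ^ 3)) * (2 / (ηr * cY) * (hρ (rhoC r w x) * Y (σ ^ 3 * rhoC r w x) *
              PredC r δ K L w x) + ∑ j ∈ Finset.range (n + 1), ((j : ℝ) + 1) * MpsiC r w x (cubeTail (Lt j))) :=
            le_mul_of_one_le_right hB₀ (by nlinarith [mul_nonneg (by positivity : (0 : ℝ) ≤ 2 / (ηr * cY)) hW0])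
          _ ≤ _ := le_add_of_nonneg_left (mul_nonneg hCh0 hε')
      · -- Case C: large dissipation
        push Not at hC
        have hYc' := hYc _ hρ1.le hρ2.le
        have hkey : 1 ≤ 2 / (ηr * cY) * (hρ (rhoC r w x) * Y (σ ^ 3 * rhoC r w x) * PredC r δ K L w x) := by
          have e : 2 / (ηr * cY) * (hρ (rhoC r w x) * Y (σ ^ 3 * rhoC r w x) * PredC r δ K L w x) =
              2 * (hρ (rhoC r w x) * Y (σ ^ 3 * rhoC r w x) * PredC r δ K L w x) / (ηr * cY) := by ring
          rw [e, le_div_iff₀ (mul_pos hηr hcY), one_mul]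
          nlinarith [hF0 (rhoC r w x)]
        calc _ ≤ Ch * (2 * Cψ * (ηP / σ ^ 3)) := hcrude
          _ ≤ Ch * (2 * Cψ * (ηP / σ ^ 3)) * (2 / (ηr * cY) * (hρ (rhoC r w x) * Y (σ ^ 3 * rhoC r w x) *
              PredC r δ K L w x) + ∑ j ∈ Finset.range (n + 1), ((j : ℝ) + 1) * MpsiC r w x (cubeTail (Lt j))) :=
            le_mul_of_one_le_right hB₀ (by linarith)
          _ ≤ _ := le_add_of_nonneg_left (mul_nonneg hCh0 hε')

/-! ## §2 The cone tails of the cubic mark along a good orbit -/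

/-- The cone `cubeTail`-moment is at most `3/(πr³)` times the mean cubic tail. [folklore] -/
theorem MpsiC_cubeTail_le {r : ℝ} (hr : 0 < r) (M : ℝ) (w : Phase N) (x : T3) :
    MpsiC r w x (cubeTail M) ≤ 3 / (Real.pi * r ^ 3) * (((N + 1 : ℕ) : ℝ)⁻¹ * ∑ i, cubeTail M (w i).2) := by
  rw [MpsiC_eq_sum]
  calc ((N + 1 : ℕ) : ℝ)⁻¹ * ∑ i, cone r (w i).1 x * cubeTail M (w i).2
      ≤ ((N + 1 : ℕ) : ℝ)⁻¹ * ∑ i, 3 / (Real.pi * r ^ 3) * cubeTail M (w i).2 :=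
        mul_le_mul_of_nonneg_left (Finset.sum_le_sum fun i _ => mul_le_mul_of_nonneg_right
          ((le_abs_self _).trans (LocalSecondLawLedger.L.abs_cone_le hr _ _)) (cubeTail_nonneg M _)) (by positivity)
    _ = 3 / (Real.pi * r ^ 3) * (((N + 1 : ℕ) : ℝ)⁻¹ * ∑ i, cubeTail M (w i).2) := by rw [← Finset.mul_sum]; ring

section Orbit

variable (Φ : HardSphereFlow (Torus.geometry (Fin 3)) (hsDiameter σ N) (N + 1)) {z : Phase N}

/-- **The weighted tail field `Σ_{j ≤ n} (j+1) M(cubeTail (Lt j))` along a good orbit is jointly measurable and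
bounded.** [folklore] -/
theorem tailField_facts (hz : z ∈ Φ.good) {r : ℝ} (hr : 0 < r) (Lt : ℕ → ℝ) (n : ℕ) :
    Measurable (uncurry fun (s : ℝ) (x : T3) =>
      ∑ j ∈ Finset.range (n + 1), ((j : ℝ) + 1) * MpsiC r (Φ.flow s z) x (cubeTail (Lt j))) ∧
    ∀ s x, |∑ j ∈ Finset.range (n + 1), ((j : ℝ) + 1) * MpsiC r (Φ.flow s z) x (cubeTail (Lt j))| ≤
      ∑ j ∈ Finset.range (n + 1), ((j : ℝ) + 1) *
        (3 / (Real.pi * r ^ 3) * (2 * ke z * Real.sqrt (2 * ((N + 1 : ℕ) : ℝ) * ke z))) := by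
  have hγ : Measurable fun s => Φ.flow s z := (Φ.isTrajectory z hz).measurable_torus
  constructor
  · refine Finset.measurable_sum _ fun j _ => ?_
    have hm := measurable_MpsiC_orbit hγ r (measurable_cubeTail (Lt j))
    exact hm.const_mul _
  · intro s x
    have hT0 : ∀ j, 0 ≤ MpsiC r (Φ.flow s z) x (cubeTail (Lt j)) := fun j =>
      MpsiC_nonneg hr _ x fun v => cubeTail_nonneg _ v
    rw [abs_of_nonneg (Finset.sum_nonneg fun j _ => mul_nonneg (by positivity) (hT0 j))]
    refine Finset.sum_le_sum fun j _ => mul_le_mul_of_nonneg_left ?_ (by positivity)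
    refine (MpsiC_cubeTail_le hr (Lt j) _ x).trans (mul_le_mul_of_nonneg_left ?_ (by positivity))
    rw [← ke_flow_eq' Φ hz s]
    exact mean_cubeTail_le (Lt j) _

/-- **The `x`-integral of the weighted tail field is the weighted mean cubic tail** (`0 < r < 1/2`). [folklore] -/
theorem integral_tailField {r : ℝ} (hr : 0 < r) (hr2 : r < 1 / 2) (Lt : ℕ → ℝ) (n : ℕ) (w : Phase N) :
    ∫ x, ∑ j ∈ Finset.range (n + 1), ((j : ℝ) + 1) * MpsiC r w x (cubeTail (Lt j)) =
      ∑ j ∈ Finset.range (n + 1), ((j : ℝ) + 1) * (((N : ℝ) + 1)⁻¹ * ∑ i, cubeTail (Lt j) (w i).2) := by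
  rw [integral_finsetSum _ fun j _ => (integrable_of_continuous_T3 (continuous_MpsiC r w _)).const_mul _]
  refine Finset.sum_congr rfl fun j _ => ?_
  rw [integral_const_mul, integral_MpsiC hr hr2 w]
  push_cast
  ring

/-! ## §3 The integrated core -/

/-- **THE DETERMINISTIC CORE, integrated along a good orbit.** Under the hypotheses of `pointwise_core` (rigidity on
the cone laws at every window, bulk-supported state weight `h`, density weight with `0 ≤ h_ρ Y ≤ C_Y`, `≥ c_Y` on the
band, `h_ρ` continuous vanishing on `[ρ̄, ∞)`, `Y` measurable), for `0 ≤ t`, `0 < r < 1/2`: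
`∫₀ᵗ∫ₓ |h(state)| · |M_ψ − ρ_r∫ψM| ≤ C_h ε′ t + B₀ (2/(η_r c_Y)) ∫₀ᵗ∫ₓ h_ρ Y 𝒫 + B₀ Σ_{j ≤ n} (j+1) ∫₀ᵗ (mean cubic tail at level Lt j)`.
[folklore] -/
theorem core_integral_le (hz : z ∈ Φ.good) (hσ : 0 < σ) {r : ℝ} (hr : 0 < r) (hr2 : r < 1 / 2) {δ : ℝ} (hδ : 0 < δ)
    (K L : ℝ) {t : ℝ} (ht : 0 ≤ t) {ψ : V3 → ℝ} {Cψ : ℝ} (hψb : ∀ v, |ψ v| ≤ Cψ)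
    (hMψ : ∀ θ : ℝ, 0 < θ → ∀ u : V3, |∫ v, ψ v * localMaxwellian 1 θ u v| ≤ Cψ)
    {h : ℝ × V3 × ℝ → ℝ} {Ch : ℝ} (hhb : ∀ p, |h p| ≤ Ch) {ρ₁ θ₁ Θ U ηP : ℝ} (hθ₁ : 0 < θ₁) (hηP : 0 ≤ ηP)
    (hsupp : ∀ p : ℝ × V3 × ℝ, (p.1 ≤ ρ₁ ∨ ηP ≤ σ ^ 3 * p.1 ∨ p.2.2 ≤ θ₁ ∨ Θ ≤ p.2.2 ∨ U ≤ ‖p.2.1‖) → h p = 0)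
    {hρ Y : ℝ → ℝ} (hhρ : Continuous hρ) (hY : Measurable Y) {CY ρb : ℝ} (hhY : ∀ a, |hρ a * Y (σ ^ 3 * a)| ≤ CY)
    (hh0 : ∀ a, ρb ≤ a → hρ a = 0) (hρb : 0 ≤ ρb) (hF0 : ∀ a, 0 ≤ hρ a * Y (σ ^ 3 * a)) {cY : ℝ} (hcY : 0 < cY)
    (hYc : ∀ a, ρ₁ ≤ a → σ ^ 3 * a ≤ ηP → cY ≤ hρ a * Y (σ ^ 3 * a))
    {Lt : ℕ → ℝ} (hLt : ∀ j, 1 ≤ Lt j) {n : ℕ} {ηr ε' : ℝ} (hηr : 0 < ηr) (hε' : 0 ≤ ε')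
    (hDRa : ∀ (w : Phase N) (x : T3), ρ₁ ≤ rhoC r w x → rhoC r w x ≤ ηP / σ ^ 3 →
      (∀ j : ℕ, j ≤ n → MpsiC r w x (sqTail (Lt j)) ≤ 1 / ((j : ℝ) + 1)) → θ₁ ≤ thetaC r w x →
      DissC r δ K L w x ≤ ηr →
      |MpsiC r w x ψ - rhoC r w x * ∫ v, ψ v * localMaxwellian 1 (thetaC r w x) (uC r w x) v| ≤ ε') :
    ∫ s in Set.Icc 0 t, ∫ x,
        |h (rhoC r (Φ.flow s z) x, uC r (Φ.flow s z) x, thetaC r (Φ.flow s z) x)| *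
          |MpsiC r (Φ.flow s z) x ψ - rhoC r (Φ.flow s z) x *
            ∫ v, ψ v * localMaxwellian 1 (thetaC r (Φ.flow s z) x) (uC r (Φ.flow s z) x) v| ≤
      Ch * ε' * t + Ch * (2 * Cψ * (ηP / σ ^ 3)) * (2 / (ηr * cY)) *
          (∫ s in Set.Icc 0 t, ∫ x, predField Φ σ r δ K L hρ Y z s x) +
        Ch * (2 * Cψ * (ηP / σ ^ 3)) * ∑ j ∈ Finset.range (n + 1), ((j : ℝ) + 1) *
          ∫ s in Set.Icc 0 t, ((N : ℝ) + 1)⁻¹ * ∑ i, cubeTail (Lt j) ((Φ.flow s z) i).2 := by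
  have hCh0 : 0 ≤ Ch := (abs_nonneg _).trans (hhb (0, 0, 0))
  have hCψ0 : 0 ≤ Cψ := (abs_nonneg _).trans (hψb 0)
  set B₀ := Ch * (2 * Cψ * (ηP / σ ^ 3)) with hB₀
  have hB₀0 : 0 ≤ B₀ := by positivity
  -- the three pieces of the dominating field
  set F : ℝ → T3 → ℝ := predField Φ σ r δ K L hρ Y z with hFdef
  have hFm : Measurable (uncurry F) := measurable_predField Φ hz σ r δ K L hhρ hY
  have hFb : ∀ s x, |F s x| ≤ CY * predBound L (ALam K δ ρb + 2 * max L 0) := abs_predField_le Φ hr hδ σ K L hhY hh0 hρb z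
  obtain ⟨hTm, hTb⟩ := tailField_facts Φ hz hr Lt n
  set T : ℝ → T3 → ℝ := fun s x => ∑ j ∈ Finset.range (n + 1), ((j : ℝ) + 1) * MpsiC r (Φ.flow s z) x (cubeTail (Lt j))
    with hTdef
  set G₁ : ℝ → T3 → ℝ := fun _ _ => Ch * ε' with hG₁
  set G₂ : ℝ → T3 → ℝ := fun s x => B₀ * (2 / (ηr * cY)) * F s x with hG₂
  set G₃ : ℝ → T3 → ℝ := fun s x => B₀ * T s x with hG₃
  have hG₁m : Measurable (uncurry G₁) := measurable_const
  have hG₁b : ∀ s x, |G₁ s x| ≤ Ch * ε' := fun s x => by rw [hG₁]; dsimp only; rw [abs_of_nonneg (mul_nonneg hCh0 hε')]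
  have hG₂m : Measurable (uncurry G₂) := hFm.const_mul _
  have hG₂b : ∀ s x, |G₂ s x| ≤ B₀ * (2 / (ηr * cY)) * (CY * predBound L (ALam K δ ρb + 2 * max L 0)) := fun s x => by
    rw [hG₂]; dsimp only; rw [abs_mul, abs_of_nonneg (by positivity : (0 : ℝ) ≤ B₀ * (2 / (ηr * cY)))]
    exact mul_le_mul_of_nonneg_left (hFb s x) (by positivity)
  have hG₃m : Measurable (uncurry G₃) := hTm.const_mul _
  have hG₃b : ∀ s x, |G₃ s x| ≤ B₀ * ∑ j ∈ Finset.range (n + 1), ((j : ℝ) + 1) *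
      (3 / (Real.pi * r ^ 3) * (2 * ke z * Real.sqrt (2 * ((N + 1 : ℕ) : ℝ) * ke z))) := fun s x => by
    rw [hG₃]; dsimp only; rw [abs_mul, abs_of_nonneg hB₀0]
    exact mul_le_mul_of_nonneg_left (hTb s x) hB₀0
  have hG₁₂m : Measurable (uncurry fun s x => G₁ s x + G₂ s x) := hG₁m.add hG₂m
  have hG₁₂b : ∀ s x, |G₁ s x + G₂ s x| ≤ Ch * ε' + B₀ * (2 / (ηr * cY)) * (CY * predBound L (ALam K δ ρb + 2 * max L 0)) :=
    fun s x => (abs_add_le _ _).trans (add_le_add (hG₁b s x) (hG₂b s x))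
  have hGm : Measurable (uncurry fun s x => G₁ s x + G₂ s x + G₃ s x) := hG₁₂m.add hG₃m
  have hGb : ∀ s x, |G₁ s x + G₂ s x + G₃ s x| ≤ Ch * ε' + B₀ * (2 / (ηr * cY)) *
      (CY * predBound L (ALam K δ ρb + 2 * max L 0)) + B₀ * ∑ j ∈ Finset.range (n + 1), ((j : ℝ) + 1) *
        (3 / (Real.pi * r ^ 3) * (2 * ke z * Real.sqrt (2 * ((N + 1 : ℕ) : ℝ) * ke z))) :=
    fun s x => (abs_add_le _ _).trans (add_le_add (hG₁₂b s x) (hG₃b s x))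
  -- pointwise domination
  have hdom : ∀ s ∈ Set.Icc (0 : ℝ) t, ∀ x,
      |(|h (rhoC r (Φ.flow s z) x, uC r (Φ.flow s z) x, thetaC r (Φ.flow s z) x)| *
        |MpsiC r (Φ.flow s z) x ψ - rhoC r (Φ.flow s z) x *
          ∫ v, ψ v * localMaxwellian 1 (thetaC r (Φ.flow s z) x) (uC r (Φ.flow s z) x) v|)| ≤
        G₁ s x + G₂ s x + G₃ s x := by
    intro s _ x
    rw [abs_of_nonneg (mul_nonneg (abs_nonneg _) (abs_nonneg _))]
    have hp := pointwise_core hr hδ hσ K L hψb hMψ hhb hθ₁ hηP hsupp hF0 hcY hYc hLt hηr hε' hDRa (Φ.flow s z) x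
    rw [hG₁, hG₂, hG₃]; dsimp only
    rw [hFdef, hTdef]; unfold predField
    linarith
  have h1 := abs_setIntegral_integral_le_of_le hGm hGb hdom
  refine ((le_abs_self _).trans h1).trans (le_of_eq ?_)
  -- evaluate `∫∫ (G₁ + G₂ + G₃)`
  rw [setIntegral_integral_add hG₁₂m hG₁₂b hG₃m hG₃b, setIntegral_integral_add hG₁m hG₁b hG₂m hG₂b]
  have e1 : ∫ s in Set.Icc 0 t, ∫ x, G₁ s x = Ch * ε' * t := by
    rw [hG₁]; dsimp only
    have hin : ∫ _x : T3, Ch * ε' = Ch * ε' := by rw [integral_const, smul_eq_mul, probReal_univ, one_mul]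
    simp_rw [hin]
    rw [setIntegral_const, smul_eq_mul, measureReal_def, Real.volume_Icc, ENNReal.toReal_ofReal (by linarith), sub_zero,
      mul_comm]
  have e2 : ∫ s in Set.Icc 0 t, ∫ x, G₂ s x = B₀ * (2 / (ηr * cY)) * ∫ s in Set.Icc 0 t, ∫ x, F s x := by
    rw [hG₂]; exact setIntegral_integral_const_mul _ F 0 t
  have e3 : ∫ s in Set.Icc 0 t, ∫ x, G₃ s x = B₀ * ∑ j ∈ Finset.range (n + 1), ((j : ℝ) + 1) *
      ∫ s in Set.Icc 0 t, ((N : ℝ) + 1)⁻¹ * ∑ i, cubeTail (Lt j) ((Φ.flow s z) i).2 := by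
    rw [hG₃, setIntegral_integral_const_mul _ T 0 t]
    congr 1
    rw [hTdef]; dsimp only
    simp_rw [integral_tailField hr hr2 Lt n]
    rw [integral_finsetSum _ fun j _ => (integrableOn_mean_cubeTail Φ (Lt j) hz 0 t).const_mul _]
    refine Finset.sum_congr rfl fun j _ => ?_
    rw [integral_const_mul]
  rw [e1, e2, e3]

end Orbit

/-! ## §4 Registered sub-goal -/

/-- **Registered sub-goal `stub_localEquilibriumFromDissipationG` (helper G of `stub_localEquilibriumFromDissipation`):
the cone `cubeTail`-moment is at most `3/(πr³)` times the mean cubic tail.** [folklore] -/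
theorem stub_localEquilibriumFromDissipationG : ∀ {N : ℕ} {r : ℝ}, 0 < r → ∀ (M : ℝ) (w : Config (N + 1) (Fin 3) T3) (x : T3), (∫ q, cone r q.1 x * Set.indicator {v : V3 | M < ‖v‖} (fun v => ‖v‖ ^ 3) q.2 ∂(empiricalMeasure w)) ≤ 3 / (Real.pi * r ^ 3) * (((N + 1 : ℕ) : ℝ)⁻¹ * ∑ i, Set.indicator {v : V3 | M < ‖v‖} (fun v => ‖v‖ ^ 3) (w i).2) :=
  fun hr M w x => MpsiC_cubeTail_le hr M w x

end Summit.AtomisticToContinuum.HydrodynamicLimit.Theorems.ChaosClosesEulerLocalEquilibriumFromDissipation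

end
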